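import Summits.CriticalPhenomena.Ising3D.TaylorRegionKernel
import Literature.Analysis.ValidatedNumerics.IntervalPolynomial
import Mathlib.RingTheory.Polynomial.Pochhammer
import Mathlib.Tactic.Linarith
import Mathlib.Tactic.Positivity
import Mathlib.Tactic.Ring
import HarnessLib

/-!
# The q-polynomial closed forms as explicit coefficient lists (bridge to the validated-numerics layer)
(cell `pub-ising3x`, seat recog-1 gen 11; gate (g2) of the M3-γ milestone — format-free glue between the
γ-chain's closed forms and the tree's interval-polynomial checkers)

HONEST FRAMING: lottery ticket; floor = tightest certified 3D Ising CFT bounds; no exact-solution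
claim without a proof.

Every number a kind-`deriv` certificate's head-cell / region check needs is, by
`taylorCoeffAt_crossF_zMono_half` and `sum_smul_taylorCoeffAt_crossF_zMono_half`, a positive prefactor times
a weighted q-sum `qSum c S s σ E j` built from the binomial sums `qFactor₁ s α a = Σ_{i+i'=a} (-1)^i C(s,i) C(α,i')`
(and `qFactor₂ = (-1)^a qFactor₁`), and the region checks are stated on the two-variable kernel
`evenKernel c S s σ u v` (`TaylorRegionKernel`, `TaylorOddConeKernel`). The tree's validated-numerics library
(`Literature.Analysis.ValidatedNumerics.PolyMP`: real "shadow" coefficient lists `evalR`/`addR`/`smulR`/`mulR`/`shiftR`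
against which the interval polynomials `IPoly`, `PMem`, `shiftI`, the sign checker `posOn` and the Taylor models are
proved sound) decides polynomial inequalities on intervals in the kernel. This file is the GENERIC bridge between
the two, proved once for all weights (no per-certificate `ring` identities):

* `descPochList n`, `chooseCoeffList n` — the generalised binomial coefficient `α ↦ C(α,n)` as a coefficient list
  (signed Stirling numbers of the first kind over `n!`): `evalR (chooseCoeffList n) α = Ring.choose α n`;
* `scaleR`, `affineR` — the substitutions `x ↦ μx`, `x ↦ μx + ν` on coefficient lists;
* `qFactor₁List s a`, `qFactor₂List s a` — `α ↦ q¹(s,α;a)`, `q²` as lists whose entries are `ℝ`-linear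
  combinations of `C(s,i) = evalR (chooseCoeffList i) s`, `i ≤ a` (so an interval enclosure of `s` over a box gives
  `PMem` by `pmem_addI`/`pmem_smulI`): `evalR (qFactor₁List s a) α = qFactor₁ s α a`;
* `evenKernel_eq_sum_evalR` — the kernel as a finite sum of PRODUCTS of two univariate list evaluations
  (the separable form a `(u,v)`-box or leading-form region check evaluates);
* `qSumRow`, `qSumListL c l s σ j` (index LIST `l`, the certificate's data) / `qSumList c S s σ j` (any `Finset`) —
  for fixed `j`, the q-sum as ONE univariate coefficient list in `E` (through `α = E/2 + (p - j/2)`):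
  `evalR (qSumList c S s σ j) E = qSum c S s σ E j`; every head-cell quantity (`X̂, Ŷ, Ẑ`, `q̂₃, q̂₄, q̂₅`,
  `Ψ(𝒫)`-sums) at `E = Δ + n` is such a list in `Δ`, ready for `shiftI`/`posOn`/Taylor-model products with the
  tree's `HRTM` coefficient models (`sum_smul_taylorCoeffAt_eq_evalR_qSumList`).

Elementary (finite sums, Horner evaluation). References: R. E. Moore, *Interval Analysis* (1966) Ch. 3
[folklore]; Kos–Poland–Simmons-Duffin 2014 §3.3 (the q-polynomial tables) [cite: KosPolandSimmonsduffin2014, §3.3].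
-/

namespace Summit.CriticalPhenomena.Ising3D

open Finset
open Literature.Analysis.ValidatedNumerics.PolyMP
open Literature.MathematicalPhysics.QuantumFieldTheory.ConformalBootstrap3D

/-! ### Finite sums of coefficient lists -/

/-- `Σ_{i<k} f i` of coefficient lists (coefficientwise). [folklore] -/
noncomputable def sumR (f : ℕ → List ℝ) : ℕ → List ℝ
  | 0 => []
  | k + 1 => addR (sumR f k) (f k)

/-- [folklore] -/
theorem evalR_sumR (f : ℕ → List ℝ) (x : ℝ) :
    ∀ k : ℕ, evalR (sumR f k) x = ∑ i ∈ range k, evalR (f i) x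
  | 0 => by simp [sumR]
  | k + 1 => by rw [sumR, evalR_addR, evalR_sumR f x k, Finset.sum_range_succ]

/-- The coefficientwise sum of the lists `f i` over a list of indices. [folklore] -/
noncomputable def sumListR {ι : Type*} (l : List ι) (f : ι → List ℝ) : List ℝ :=
  l.foldr (fun i acc => addR (f i) acc) []

/-- [folklore] -/
theorem evalR_sumListR {ι : Type*} (f : ι → List ℝ) (x : ℝ) :
    ∀ l : List ι, evalR (sumListR l f) x = (l.map fun i => evalR (f i) x).sum
  | [] => by simp [sumListR]
  | i :: l => by
      have h := evalR_sumListR f x l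
      simp only [sumListR, List.foldr_cons, List.map_cons, List.sum_cons] at h ⊢
      rw [evalR_addR, h]

/-- For a duplicate-free index list the value is the `Finset` sum over `l.toFinset`. [folklore] -/
theorem evalR_sumListR_toFinset {ι : Type*} [DecidableEq ι] (f : ι → List ℝ) (x : ℝ) {l : List ι}
    (hl : l.Nodup) : evalR (sumListR l f) x = ∑ i ∈ l.toFinset, evalR (f i) x := by
  rw [evalR_sumListR, List.sum_toFinset _ hl]

/-- The coefficientwise sum of the lists `f i` over a `Finset` (through `Finset.toList`; the canonical,
order-agnostic shadow — a table uses `sumListR` on its own index list). [folklore] -/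
noncomputable def finSumR {ι : Type*} (S : Finset ι) (f : ι → List ℝ) : List ℝ := sumListR S.toList f

/-- [folklore] -/
theorem evalR_finSumR {ι : Type*} (S : Finset ι) (f : ι → List ℝ) (x : ℝ) :
    evalR (finSumR S f) x = ∑ i ∈ S, evalR (f i) x := by
  rw [finSumR, evalR_sumListR, Finset.sum_map_toList]

/-! ### Substitutions `x ↦ μ x` and `x ↦ μ x + ν` -/

/-- The coefficients of `p(μ x)`: the `k`-th coefficient times `μ^k`. [folklore] -/
noncomputable def scaleR : List ℝ → ℝ → List ℝ
  | [], _ => []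
  | a :: as, μ => a :: smulR μ (scaleR as μ)

/-- [folklore] -/
theorem evalR_scaleR : ∀ (as : List ℝ) (μ x : ℝ), evalR (scaleR as μ) x = evalR as (μ * x)
  | [], μ, x => by simp [scaleR]
  | a :: as, μ, x => by
      rw [scaleR, evalR_cons, evalR_smulR, evalR_scaleR as μ x, evalR_cons]; ring

/-- The coefficients of `p(μ x + ν)` (Taylor shift to `ν`, then scaling). [folklore] -/
noncomputable def affineR (as : List ℝ) (μ ν : ℝ) : List ℝ := scaleR (shiftR as ν) μ

/-- [folklore] -/
theorem evalR_affineR (as : List ℝ) (μ ν x : ℝ) : evalR (affineR as μ ν) x = evalR as (μ * x + ν) := by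
  rw [affineR, evalR_scaleR, evalR_shiftR, add_comm]

/-! ### The generalised binomial coefficient as a coefficient list -/

/-- `Ring.choose α n = (descPochhammer ℝ n).eval α / n!` (`α(α-1)⋯(α-n+1)/n!`). [folklore] -/
theorem choose_eq_descPochhammer_div (α : ℝ) (n : ℕ) :
    Ring.choose α n = (descPochhammer ℝ n).eval α / (n.factorial : ℝ) := by
  rw [choose_eq_ascPochhammer_div, descPochhammer_eval_eq_ascPochhammer]

/-- The falling factorial `α(α-1)⋯(α-n+1)` as a coefficient list (`[1]`, then `· × (X - n)`); its entries are
the signed Stirling numbers of the first kind. [folklore] -/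
noncomputable def descPochList : ℕ → List ℝ
  | 0 => [1]
  | n + 1 => mulR (descPochList n) [-(n : ℝ), 1]

/-- [folklore] -/
theorem evalR_descPochList : ∀ (n : ℕ) (α : ℝ), evalR (descPochList n) α = (descPochhammer ℝ n).eval α
  | 0, α => by simp [descPochList]
  | n + 1, α => by
      rw [descPochList, evalR_mulR, evalR_descPochList n α, descPochhammer_succ_eval]
      simp only [evalR_cons, evalR_nil]
      ring

/-- `α ↦ C(α,n)` as a coefficient list: `descPochList n / n!`. [folklore] -/
noncomputable def chooseCoeffList (n : ℕ) : List ℝ := smulR ((n.factorial : ℝ)⁻¹) (descPochList n)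

/-- **`evalR (chooseCoeffList n) α = C(α,n)`** for every real `α`. [folklore] -/
theorem evalR_chooseCoeffList (n : ℕ) (α : ℝ) : evalR (chooseCoeffList n) α = Ring.choose α n := by
  rw [chooseCoeffList, evalR_smulR, evalR_descPochList, choose_eq_descPochhammer_div, div_eq_inv_mul]

/-- Fixture: `chooseCoeffList 3 = [0, 1/3, -1/2, 1/6]` (`C(α,3) = α/3 - α²/2 + α³/6`). [folklore] -/
theorem chooseCoeffList_three : chooseCoeffList 3 = [0, 1 / 3, -1 / 2, 1 / 6] := by
  norm_num [chooseCoeffList, descPochList, mulR, addR, smulR, Nat.factorial]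

/-! ### The binomial sums `q¹`, `q²` as coefficient lists in `α` -/

/-- `α ↦ q¹(s,α;a) = Σ_{i+i'=a} (-1)^i C(s,i) C(α,i')` as a coefficient list (entries linear in the
`C(s,i)`, `i ≤ a`). [folklore] -/
noncomputable def qFactor₁List (s : ℝ) (a : ℕ) : List ℝ :=
  sumR (fun i => smulR ((-1) ^ i * Ring.choose s i) (chooseCoeffList (a - i))) (a + 1)

/-- **`evalR (qFactor₁List s a) α = q¹(s,α;a)`.** [folklore] -/
theorem evalR_qFactor₁List (s α : ℝ) (a : ℕ) : evalR (qFactor₁List s a) α = qFactor₁ s α a := by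
  rw [qFactor₁List, evalR_sumR, qFactor₁, Finset.Nat.sum_antidiagonal_eq_sum_range_succ_mk]
  refine Finset.sum_congr rfl fun i _ => ?_
  rw [evalR_smulR, evalR_chooseCoeffList]

/-- `α ↦ q²(s,α;a) = (-1)^a q¹(s,α;a)` as a coefficient list. [folklore] -/
noncomputable def qFactor₂List (s : ℝ) (a : ℕ) : List ℝ := smulR ((-1) ^ a) (qFactor₁List s a)

/-- **`evalR (qFactor₂List s a) α = q²(s,α;a)`.** [folklore] -/
theorem evalR_qFactor₂List (s α : ℝ) (a : ℕ) : evalR (qFactor₂List s a) α = qFactor₂ s α a := by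
  rw [qFactor₂List, evalR_smulR, evalR_qFactor₁List, qFactor₂_eq]

/-! ### The two-variable kernel in separable list form -/

/-- **The kernel is a finite sum of products of two univariate list evaluations**:
`K_c(u,v) = Σ_{(a,b)∈S} c(a,b) 2^{a+b} (1 + σ(-1)^{a+b}) · p_a(u) · p_b(v)` with `p_a = qFactor₁List s a`.
[folklore] -/
theorem evenKernel_eq_sum_evalR (c : ℕ × ℕ → ℝ) (S : Finset (ℕ × ℕ)) (s σ u v : ℝ) :
    evenKernel c S s σ u v = ∑ ab ∈ S, c ab * 2 ^ (ab.1 + ab.2) * (1 + σ * (-1) ^ (ab.1 + ab.2)) *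
      (evalR (qFactor₁List s ab.1) u * evalR (qFactor₁List s ab.2) v) := by
  unfold evenKernel
  simp_rw [evalR_qFactor₁List]

/-! ### The weighted q-sum as ONE coefficient list in `E` (fixed `j`) -/

/-- `α = (E - j)/2 + p` is the affine substitution `E ↦ E/2 + (p - j/2)`. [folklore] -/
theorem evalR_affineR_half (l : List ℝ) (p j : ℕ) (E : ℝ) :
    evalR (affineR l (1 / 2) ((p : ℝ) - (j : ℝ) / 2)) E = evalR l ((E - (j : ℝ)) / 2 + p) := by
  rw [evalR_affineR]
  congr 1
  ring

/-- The `(a,b)`-term of the q-sum as a coefficient list in `E` (fixed `j`):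
`c 2^{a+b} Σ_{p=0}^{j} λ_p λ_{j-p} (p_a∘τ_p · p_b∘τ_{j-p} + σ · p'_a∘τ_p · p'_b∘τ_{j-p})`, `τ_p(E) = E/2 + (p - j/2)`.
[folklore] -/
noncomputable def qSumRow (c : ℕ × ℕ → ℝ) (s σ : ℝ) (j : ℕ) (ab : ℕ × ℕ) : List ℝ :=
  smulR (c ab * 2 ^ (ab.1 + ab.2))
    (sumR (fun p => smulR (legendreLam p * legendreLam (j - p))
      (addR
        (mulR (affineR (qFactor₁List s ab.1) (1 / 2) ((p : ℝ) - (j : ℝ) / 2))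
          (affineR (qFactor₁List s ab.2) (1 / 2) (((j - p : ℕ) : ℝ) - (j : ℝ) / 2)))
        (smulR σ (mulR (affineR (qFactor₂List s ab.1) (1 / 2) ((p : ℝ) - (j : ℝ) / 2))
          (affineR (qFactor₂List s ab.2) (1 / 2) (((j - p : ℕ) : ℝ) - (j : ℝ) / 2)))))) (j + 1))

/-- [folklore] -/
theorem evalR_qSumRow (c : ℕ × ℕ → ℝ) (s σ : ℝ) (j : ℕ) (ab : ℕ × ℕ) (E : ℝ) :
    evalR (qSumRow c s σ j ab) E = c ab * 2 ^ (ab.1 + ab.2) *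
      ∑ p ∈ antidiagonal j, legendreLam p.1 * legendreLam p.2 *
        (qFactor₁ s ((E - (j : ℝ)) / 2 + p.1) ab.1 * qFactor₁ s ((E - (j : ℝ)) / 2 + p.2) ab.2 +
          σ * (qFactor₂ s ((E - (j : ℝ)) / 2 + p.1) ab.1 * qFactor₂ s ((E - (j : ℝ)) / 2 + p.2) ab.2)) := by
  rw [qSumRow, evalR_smulR, evalR_sumR, Finset.Nat.sum_antidiagonal_eq_sum_range_succ_mk]
  congr 1
  refine Finset.sum_congr rfl fun p _ => ?_
  rw [evalR_smulR, evalR_addR, evalR_mulR, evalR_smulR, evalR_mulR, evalR_affineR_half,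
    evalR_affineR_half, evalR_affineR_half, evalR_affineR_half, evalR_qFactor₁List, evalR_qFactor₁List,
    evalR_qFactor₂List, evalR_qFactor₂List]

/-- For fixed `j` and an index LIST `l` (a certificate's `S` as data), the weighted q-sum
`E ↦ qSum c l.toFinset s σ E j` as a coefficient list in `E` (the shape an interval twin mirrors). [folklore] -/
noncomputable def qSumListL (c : ℕ × ℕ → ℝ) (l : List (ℕ × ℕ)) (s σ : ℝ) (j : ℕ) : List ℝ :=
  sumListR l (qSumRow c s σ j)

/-- **`evalR (qSumListL c l s σ j) E = qSum c l.toFinset s σ E j`** (`l` duplicate-free). [folklore] -/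
theorem evalR_qSumListL (c : ℕ × ℕ → ℝ) {l : List (ℕ × ℕ)} (hl : l.Nodup) (s σ : ℝ) (j : ℕ) (E : ℝ) :
    evalR (qSumListL c l s σ j) E = qSum c l.toFinset s σ E j := by
  rw [qSumListL, evalR_sumListR_toFinset _ _ hl, qSum]
  exact Finset.sum_congr rfl fun ab _ => evalR_qSumRow c s σ j ab E

/-- For fixed `j`, the weighted q-sum `E ↦ qSum c S s σ E j` as a coefficient list in `E` (canonical shadow,
any `Finset`). [folklore] -/
noncomputable def qSumList (c : ℕ × ℕ → ℝ) (S : Finset (ℕ × ℕ)) (s σ : ℝ) (j : ℕ) : List ℝ :=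
  finSumR S (qSumRow c s σ j)

/-- **`evalR (qSumList c S s σ j) E = qSum c S s σ E j`** for every real `E`. [folklore] -/
theorem evalR_qSumList (c : ℕ × ℕ → ℝ) (S : Finset (ℕ × ℕ)) (s σ : ℝ) (j : ℕ) (E : ℝ) :
    evalR (qSumList c S s σ j) E = qSum c S s σ E j := by
  rw [qSumList, evalR_finSumR, qSum]
  exact Finset.sum_congr rfl fun ab _ => evalR_qSumRow c s σ j ab E

/-- Hence every component value on a term is a prefactor times ONE list evaluation:
`(Σ_{ab∈S} c ab • taylorCoeffAt ½ ½ ab)(crossF s σ 𝒫_{E,j}) = (½)^{2s} (½)^E · evalR (qSumList c S s σ j) E`.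
[folklore] -/
theorem sum_smul_taylorCoeffAt_eq_evalR_qSumList (c : ℕ × ℕ → ℝ) (S : Finset (ℕ × ℕ)) (s σ E : ℝ)
    (j : ℕ) (hEj : (j : ℝ) ≤ E) :
    (∑ ab ∈ S, c ab • taylorCoeffAt (1 / 2) (1 / 2) ab) (crossF s σ (zMono E j)) =
      (1 / 2 : ℝ) ^ (2 * s) * (1 / 2 : ℝ) ^ E * evalR (qSumList c S s σ j) E := by
  rw [evalR_qSumList, sum_smul_taylorCoeffAt_crossF_zMono_half c S s σ E j hEj]

end Summit.CriticalPhenomena.Ising3D
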